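import Summits.BirchSwinnertonDyer.BirchSwinnertonDyer.Theorems.ManinLocalTwoThreeSymbolHeckeShift
import Mathlib.Algebra.Polynomial.AlgebraMap
import HarnessLib

/-!
# THE LIFT of E-es-35: a parabolic, shift-invariant generalised eigenclass `u ∈ Hom(Γ₀(L), K)` is the boundary map of a
# `Γ₀(L)`-invariant cusp symbol that is ALSO `A = diag(d,1)`-invariant — GIVEN that a Hecke polynomial fixing `u` kills
# the boundary symbols of level `L'` (hypothesis (BND), = E-es-30 + linear algebra), by the POLYNOMIAL-PROJECTOR trick
# (no finite-dimensionality of cocycles or symbols, no commutativity of Hecke operators is used)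

Summit `BirchSwinnertonDyer`, route `ManinLocalTwoThree` (cell bsd-f2-manin), cruxes C2 `ManinOddAtFour`
(stmt-BirchSwinnertonDyer-22967) / C3 `ManinPrimeToThreeAtNine` (stmt-BirchSwinnertonDyer-22968); registered stubs
`stub_relativeIharaBarTwo` / `stub_relativeIharaBar331` = leaf E-es-25 ⟸ E-es-35 `ShiftInvariantIsDiamond`, whose core below
the lift is landed (`exists_diamondFun_of_invariant_of_shift_invariant`, p3; LEMMA G, p1).  MEMO-es §23.2 obtains the
`A`-invariant lift «inside the λ-generalised eigenspace of the finite-dimensional Hecke module Symb^{Γ₀(L)}»; this file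
replaces that by an argument needing neither finite-dimensionality nor commuting Hecke operators:

Take ANY `Γ₀(L)`-invariant lift `Φ₀` of the parabolic class `u` (p2's E-es-29a (i) `exists_cuspSymbol_of_parabolic_hom`).
Its discrepancy `D₀ = Φ₀∘A − Φ₀` is a boundary symbol of level `L'` (p3 `exists_boundary_of_shiftInvariant`).  For a word of
Hecke polynomials `(r₁,q₁), …, (r_m,q_m)` (primes `rᵢ ∉ S`, `rᵢ ∤ d`) put `Φ₁ := q₁(T_{r₁})(⋯ q_m(T_{r_m}) Φ₀)`.  Then
(`hecke_word_*` below): `Φ₁` is `Γ₀(L)`-invariant and additive; `δΦ₁ = q₁(T_{r₁})⋯(δΦ₀)` on cochains (dictionary, iterated —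
`delta_symbolHecke_eq_heckeU`); `Φ₁∘A − Φ₁ = q₁(T_{r₁})⋯ D₀` (`T_r` commutes with `∘A`, `symbolHecke_diagShift_comm`).  If each
`q_i ≡ 1 mod (X − λ(r_i))^{k_i}` with `(T_{r_i} − λ(r_i))^{k_i} u = 0`, then `qᵢ(T_{rᵢ}) u = u`, so `δΦ₁ = u`
(`aeval_heckeU_eq_self_of_dvd`); and if the word KILLS every boundary symbol of level `L'` — hypothesis **(BND)**, which is where
E-es-30 `BoundaryEisenstein (L')` enters (the word is the product of the spectral projectors onto the `λ(rᵢ)`-primary parts of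
the finite-dimensional boundary module, empty for `λ̄` non-Eisenstein) — then `Φ₁∘A = Φ₁`.

* **`exists_shift_invariant_lift_of_boundaryKilled`** — the LIFT: under (BND) (stated for the exponents `k_r` read off `u`),
  a parabolic shift-invariant generalised `λ`-eigen cocycle `u` on `Γ₀(L)` is `δΦ` for an additive symbol `Φ` invariant under
  `Γ₀(L)` and under `A`.

With `exists_diamondFun_of_invariant_of_shift_invariant` and `eq_zero_of_coe_eq_diamondFun` (p3) this proves E-es-35 from
(BND) and PARABOLICITY (next file: the assembly by name).  Nothing about BSD or Manin's conjecture is proved here.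

References: HOME/MEMO-es.md §22.2 (1)–(2), §23.2 (cell bsd-f2-manin); [Shimura1971] §8.3; [DiamondShurman2005] §5.2.
-/

set_option autoImplicit false
set_option linter.dupNamespace false

open scoped MatrixGroups Polynomial

open CongruenceSubgroup Matrix.SpecialLinearGroup Polynomial Literature.NumberTheory.EllipticCurves.ModularForms
  Literature.NumberTheory.EllipticCurves.ModularForms.HidaCohomology

namespace Summit.BirchSwinnertonDyer.BirchSwinnertonDyer.Theorems.ManinLocalTwoThree

noncomputable section

/-! ### §1  Polynomial calculus for an endomorphism -/

section Poly

variable {K M : Type*} [CommRing K] [AddCommGroup M] [Module K M] (T : Module.End K M)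

/-- `aeval T (monomial n a) x = a • Tⁿ x` (plumbing). [folklore] -/
theorem aeval_monomial_apply (n : ℕ) (a : K) (x : M) : aeval T (monomial n a) x = a • (T ^ n) x := by
  rw [aeval_monomial, Module.End.mul_apply, Module.algebraMap_end_apply]

/-- A `T`-stable class of vectors is `Tⁿ`-stable. [folklore] -/
theorem pow_apply_induction (P : M → Prop) (hT : ∀ x, P x → P (T x)) (n : ℕ) : ∀ x, P x → P ((T ^ n) x) := by
  induction n with
  | zero => intro x hx; simpa using hx
  | succ n ih => intro x hx; rw [pow_succ', Module.End.mul_apply]; exact hT _ (ih x hx)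

/-- **Induction principle**: a property of vectors closed under `+`, scalars and `T` is preserved by every `q(T)`.
[folklore] -/
theorem aeval_induction (P : M → Prop) (hadd : ∀ x y, P x → P y → P (x + y))
    (hsmul : ∀ (c : K) (x : M), P x → P (c • x)) (hT : ∀ x, P x → P (T x)) (q : K[X]) :
    ∀ x, P x → P (aeval T q x) := by
  induction q using Polynomial.induction_on' with
  | add p q hp hq => intro x hx; rw [map_add, LinearMap.add_apply]; exact hadd _ _ (hp x hx) (hq x hx)
  | monomial n a => intro x hx; rw [aeval_monomial_apply]; exact hsmul _ _ (pow_apply_induction T P hT n x hx)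

/-- **Intertwining extends to polynomials**: if `δ ∘ T = U ∘ δ` on a `T`-stable class of vectors, then
`δ (q(T) x) = q(U) (δ x)` there. [folklore] -/
theorem aeval_intertwine {M' : Type*} [AddCommGroup M'] [Module K M'] (U : Module.End K M') (δ : M →ₗ[K] M')
    (P : M → Prop) (hT : ∀ x, P x → P (T x)) (hδ : ∀ x, P x → δ (T x) = U (δ x)) (q : K[X]) :
    ∀ x, P x → δ (aeval T q x) = aeval U q (δ x) := by
  have hpow : ∀ (n : ℕ) (x : M), P x → δ ((T ^ n) x) = (U ^ n) (δ x) := by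
    intro n
    induction n with
    | zero => intro x _; simp
    | succ n ih =>
      intro x hx
      rw [pow_succ', Module.End.mul_apply, pow_succ', Module.End.mul_apply, hδ _ (pow_apply_induction T P hT n x hx),
        ih x hx]
  induction q using Polynomial.induction_on' with
  | add p q hp hq => intro x hx; rw [map_add, LinearMap.add_apply, map_add, map_add, LinearMap.add_apply, hp x hx, hq x hx]
  | monomial n a => intro x hx; rw [aeval_monomial_apply, aeval_monomial_apply, map_smul, hpow n x hx]

/-- **A polynomial `≡ 1 mod (X − λ)ᵏ` fixes every vector killed by `(T − λ)ᵏ`.** [folklore] -/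
theorem aeval_eq_self_of_dvd {lam : K} {k : ℕ} {q : K[X]} (hq : (X - C lam) ^ k ∣ q - 1) (x : M)
    (hx : ((T - lam • (1 : Module.End K M)) ^ k) x = 0) : aeval T q x = x := by
  obtain ⟨s, hs⟩ := hq
  have e : q = 1 + s * (X - C lam) ^ k := by rw [mul_comm, ← hs]; ring
  have hk : aeval T ((X - C lam) ^ k) = (T - lam • (1 : Module.End K M)) ^ k := by
    rw [map_pow, map_sub, aeval_X, aeval_C, Algebra.algebraMap_eq_smul_one]
  rw [e, map_add, map_one, map_mul, LinearMap.add_apply, Module.End.one_apply, Module.End.mul_apply, hk, hx, map_zero,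
    add_zero]

end Poly

/-! ### §2  Hecke words on symbols and cochains -/


section Lift

variable {K : Type*} [Field K] {L L' d : ℕ} [NeZero d] (h : L * d ∣ L') (h1 : L * 1 ∣ L')
  (A : GL (Fin 2) ℚ) (hA : (A : Matrix (Fin 2) (Fin 2) ℚ) = !![(d : ℚ), 0; 0, 1])

include hA

/-- **THE LIFT (MEMO-es §23.2, polynomial-projector form).**  Let `u ∈ Hom(Γ₀(L), K)` be a generalised `λ`-eigen cocycle
(`ℓ ∉ S`), PARABOLIC (kills every `γ ∈ Γ₀(L)` fixing a point of `P¹(ℚ)`) and SHIFT-INVARIANT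
(`π_d^* u = π_1^* u` on `Γ₀(L')`, `L d ∣ L'`).  Suppose (BND): for the exponents `k` read off `u` there is a word of Hecke
polynomials `(rᵢ, qᵢ)` — primes `rᵢ ∉ S`, `rᵢ ∤ d`, `rᵢ ∤ L'`, `qᵢ ≡ 1 mod (X − λ(rᵢ))^{k rᵢ}` — killing every boundary symbol
of level `L'`.  Then `u = δΦ` for an additive cusp symbol `Φ` invariant under `Γ₀(L)` AND under `A = diag(d, 1)`. [folklore] -/
theorem exists_shift_invariant_lift_of_boundaryKilled {S : Finset ℕ} (lam : ℕ → K) (u : cocycles 0 L K) (hu : IsHeckeGenEigenvector S lam u)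
    (hpar : ∀ γ : Gamma0 L, ∀ c : OnePoint ℚ, mapGL ℚ (γ : SL(2, ℤ)) • c = c → (u : Gamma0 L → Fin 1 → K) γ 0 = 0)
    (hshift : degeneracyPullback 0 L L' d K h (u : Gamma0 L → Fin 1 → K) =
      degeneracyPullback 0 L L' 1 K h1 (u : Gamma0 L → Fin 1 → K))
    (hBND : ∀ k : ℕ → ℕ, ∃ F : List ({r : ℕ // r.Prime} × K[X]),
      (∀ rq ∈ F, rq.1.1 ∉ S ∧ ¬ rq.1.1 ∣ d ∧ ¬ rq.1.1 ∣ L' ∧ (X - C (lam rq.1.1)) ^ (k rq.1.1) ∣ rq.2 - 1) ∧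
      ∀ Ψ : OnePoint ℚ → OnePoint ℚ → K, (∀ a b c, Ψ a b + Ψ b c = Ψ a c) →
        (∀ γ : Gamma0 L', ∀ a b, Ψ (mapGL ℚ (γ : SL(2, ℤ)) • a) (mapGL ℚ (γ : SL(2, ℤ)) • b) = Ψ a b) →
        (∀ γ : Gamma0 L', Ψ OnePoint.infty (mapGL ℚ (γ : SL(2, ℤ)) • OnePoint.infty) = 0) →
        F.foldr (fun rq Ψ => aeval (@symbolHecke L rq.1.1 ⟨rq.1.2.ne_zero⟩ K _) rq.2 Ψ) Ψ = 0) :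
    ∃ Φ : OnePoint ℚ → OnePoint ℚ → K, (∀ a b c, Φ a b + Φ b c = Φ a c) ∧
      (∀ γ : Gamma0 L, ∀ a b, Φ (mapGL ℚ (γ : SL(2, ℤ)) • a) (mapGL ℚ (γ : SL(2, ℤ)) • b) = Φ a b) ∧
      (∀ a b, Φ (A • a) (A • b) = Φ a b) ∧
      (fun (γ : Gamma0 L) (_ : Fin 1) => Φ OnePoint.infty (mapGL ℚ (γ : SL(2, ℤ)) • OnePoint.infty)) =
        (u : Gamma0 L → Fin 1 → K) := by
  classical
  -- exponents: `(T_r − λ_r)^{k r} u = 0` for primes `r ∉ S`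
  have hk : ∀ r : ℕ, ∃ kr : ℕ, ∀ (hr : r.Prime), r ∉ S →
      ((@heckeUZ 0 L K _ r ⟨hr.ne_zero⟩ hr - lam r • (1 : Module.End K (cocycles 0 L K))) ^ kr) u = 0 := by
    intro r
    by_cases hr : r.Prime
    · by_cases hrS : r ∈ S
      · exact ⟨0, fun _ h => absurd hrS h⟩
      · haveI : NeZero r := ⟨hr.ne_zero⟩
        obtain ⟨kr, hkr⟩ := (isHeckeGenEigenvector_iff S lam u).1 hu r hr hrS
        exact ⟨kr, fun _ _ => hkr⟩
    · exact ⟨0, fun hr' _ => absurd hr' hr⟩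
  choose k hk using hk
  obtain ⟨F, hF, hkill⟩ := hBND k
  -- the lift
  obtain ⟨Φ₀, hsym₀, hinv₀, hδ₀⟩ := exists_cuspSymbol_of_parabolic_hom L (fun γ => (u : Gamma0 L → Fin 1 → K) γ 0)
    (fun γ γ' => by
      have := congrFun ((mem_cocycles_iff.mp u.2) γ γ') 0
      simpa [act_zero_eq_id, add_comm] using this)
    hpar
  -- the word applied to a symbol / a cochain
  let wordS : (OnePoint ℚ → OnePoint ℚ → K) → (OnePoint ℚ → OnePoint ℚ → K) := fun Ψ =>
    F.foldr (fun rq Ψ => aeval (@symbolHecke L rq.1.1 ⟨rq.1.2.ne_zero⟩ K _) rq.2 Ψ) Ψ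
  -- class of invariant additive symbols at level `L`
  let P : (OnePoint ℚ → OnePoint ℚ → K) → Prop := fun Φ =>
    (∀ a b c, Φ a b + Φ b c = Φ a c) ∧
      ∀ γ : Gamma0 L, ∀ a b, Φ (mapGL ℚ (γ : SL(2, ℤ)) • a) (mapGL ℚ (γ : SL(2, ℤ)) • b) = Φ a b
  -- closure properties of `P`
  have cadd : ∀ x y, P x → P y → P (x + y) := by
    rintro x y ⟨hx1, hx2⟩ ⟨hy1, hy2⟩
    refine ⟨fun a b c => ?_, fun γ a b => ?_⟩
    · simp only [Pi.add_apply]; rw [← hx1 a b c, ← hy1 a b c]; abel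
    · simp only [Pi.add_apply]; rw [hx2, hy2]
  have csmul : ∀ (c : K) x, P x → P (c • x) := by
    rintro c x ⟨hx1, hx2⟩
    refine ⟨fun a b c' => ?_, fun γ a b => ?_⟩
    · simp only [Pi.smul_apply, smul_eq_mul]; rw [← hx1 a b c']; ring
    · simp only [Pi.smul_apply]; rw [hx2]
  have cT : ∀ (r : {r : ℕ // r.Prime}) (x), P x → P (@symbolHecke L r.1 ⟨r.2.ne_zero⟩ K _ x) := by
    rintro r x ⟨hx1, hx2⟩
    haveI : NeZero r.1 := ⟨r.2.ne_zero⟩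
    exact ⟨symbolHecke_isSymbol L r.1 K hx1, symbolHecke_invariant r.2 x hx2⟩
  -- the boundary map at level `L` as a linear map
  let δ : (OnePoint ℚ → OnePoint ℚ → K) →ₗ[K] (Gamma0 L → Fin 1 → K) :=
    { toFun := fun Φ γ _ => Φ OnePoint.infty (mapGL ℚ (γ : SL(2, ℤ)) • OnePoint.infty)
      map_add' := fun _ _ => rfl
      map_smul' := fun _ _ => rfl }
  -- (1) the word preserves `P` and intertwines `δ` with the cochain word, which FIXES `↑u`
  have step : ∀ (G : List ({r : ℕ // r.Prime} × K[X])), (∀ rq ∈ G, rq ∈ F) → ∀ Ψ, P Ψ → δ Ψ = (u : Gamma0 L → Fin 1 → K) →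
      P (G.foldr (fun rq Ψ => aeval (@symbolHecke L rq.1.1 ⟨rq.1.2.ne_zero⟩ K _) rq.2 Ψ) Ψ) ∧
        δ (G.foldr (fun rq Ψ => aeval (@symbolHecke L rq.1.1 ⟨rq.1.2.ne_zero⟩ K _) rq.2 Ψ) Ψ) =
          (u : Gamma0 L → Fin 1 → K) := by
    intro G
    induction G with
    | nil => intro _ Ψ hP hδΨ; exact ⟨hP, hδΨ⟩
    | cons rq G ih =>
      intro hG Ψ hP hδΨ
      have hGF : ∀ rq' ∈ G, rq' ∈ F := fun rq' h' => hG rq' (List.mem_cons_of_mem _ h')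
      obtain ⟨hP', hδ'⟩ := ih hGF Ψ hP hδΨ
      obtain ⟨hrS, -, -, hq⟩ := hF rq (hG rq (List.mem_cons_self))
      haveI : NeZero rq.1.1 := ⟨rq.1.2.ne_zero⟩
      rw [List.foldr_cons]
      refine ⟨aeval_induction _ P cadd csmul (cT rq.1) rq.2 _ hP', ?_⟩
      -- `δ (q(T_r) Ψ') = q(heckeU) (δ Ψ') = q(heckeU) ↑u = ↑u`
      have hinter := aeval_intertwine (@symbolHecke L rq.1.1 ⟨rq.1.2.ne_zero⟩ K _) (heckeU 0 L K rq.1.2) δ P (cT rq.1)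
        (fun x hx => delta_symbolHecke_eq_heckeU rq.1.2 x hx.1 hx.2) rq.2 _ hP'
      rw [hinter, hδ']
      -- `q(heckeU) ↑u = ↑u` from `(heckeUZ − λ)^k u = 0`
      have hfix := aeval_eq_self_of_dvd (heckeUZ 0 L K rq.1.2) hq u (hk rq.1.1 rq.1.2 hrS)
      have hcoe : ∀ (s : K[X]), ((aeval (heckeUZ 0 L K rq.1.2) s u : cocycles 0 L K) : Gamma0 L → Fin 1 → K) =
          aeval (heckeU 0 L K rq.1.2) s (u : Gamma0 L → Fin 1 → K) := by
        intro s
        induction s using Polynomial.induction_on' with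
        | add p q hp hq' => rw [map_add, map_add, LinearMap.add_apply, LinearMap.add_apply, Submodule.coe_add, hp, hq']
        | monomial n a =>
          rw [aeval_monomial_apply, aeval_monomial_apply, Submodule.coe_smul, coe_heckeUZ_pow]
      rw [← hcoe, hfix]
  -- (2) the lifted symbol
  have hδΦ₀ : δ Φ₀ = (u : Gamma0 L → Fin 1 → K) := by
    funext γ i
    obtain rfl : i = 0 := Subsingleton.elim _ _
    exact hδ₀ γ
  obtain ⟨hP₁, hδ₁⟩ := step F (fun _ h => h) Φ₀ ⟨hsym₀, hinv₀⟩ hδΦ₀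
  refine ⟨wordS Φ₀, hP₁.1, hP₁.2, ?_, hδ₁⟩
  -- (3) `A`-invariance: `wordS Φ₀ ∘ A − wordS Φ₀ = wordS D₀ = 0`
  -- the discrepancy `D₀` is a boundary symbol of level `L'`
  obtain ⟨hsymD, hinvD, hδD, -⟩ := exists_boundary_of_shiftInvariant h h1 A hA Φ₀ hsym₀ hinv₀
    (by rw [show (fun (γ : Gamma0 L) (_ : Fin 1) => Φ₀ OnePoint.infty (mapGL ℚ (γ : SL(2, ℤ)) • OnePoint.infty)) =
        (u : Gamma0 L → Fin 1 → K) from hδΦ₀]; exact hshift)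
  have hkillD := hkill (fun a b => Φ₀ (A • a) (A • b) - Φ₀ a b) hsymD hinvD hδD
  -- the word commutes with `∘A` and with subtraction on `Γ₀(L)`-invariant symbols
  have comm : ∀ (G : List ({r : ℕ // r.Prime} × K[X])), (∀ rq ∈ G, rq ∈ F) → ∀ Ψ, P Ψ →
      symbolShift K (fun x => A • x) (G.foldr (fun rq Ψ => aeval (@symbolHecke L rq.1.1 ⟨rq.1.2.ne_zero⟩ K _) rq.2 Ψ) Ψ) =
        G.foldr (fun rq Ψ => aeval (@symbolHecke L rq.1.1 ⟨rq.1.2.ne_zero⟩ K _) rq.2 Ψ) (symbolShift K (fun x => A • x) Ψ) := by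
    intro G
    induction G with
    | nil => intro _ Ψ _; rfl
    | cons rq G ih =>
      intro hG Ψ hP
      have hGF : ∀ rq' ∈ G, rq' ∈ F := fun rq' h' => hG rq' (List.mem_cons_of_mem _ h')
      obtain ⟨-, hrd, -, -⟩ := hF rq (hG rq (List.mem_cons_self))
      haveI : NeZero rq.1.1 := ⟨rq.1.2.ne_zero⟩
      rw [List.foldr_cons, List.foldr_cons, ← ih hGF Ψ hP]
      -- `symbolShift A (q(T) Ψ') = q(T) (symbolShift A Ψ')` for `P Ψ'`
      -- `P` is preserved by any word
      have hPG : ∀ (G' : List ({r : ℕ // r.Prime} × K[X])) (Ψ'), P Ψ' →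
          P (G'.foldr (fun rq Ψ => aeval (@symbolHecke L rq.1.1 ⟨rq.1.2.ne_zero⟩ K _) rq.2 Ψ) Ψ') := by
        intro G'
        induction G' with
        | nil => intro Ψ' h'; exact h'
        | cons rq' G' ih' =>
          intro Ψ' h'
          rw [List.foldr_cons]
          exact aeval_induction _ P cadd csmul (cT rq'.1) rq'.2 _ (ih' Ψ' h')
      exact aeval_intertwine (@symbolHecke L rq.1.1 ⟨rq.1.2.ne_zero⟩ K _) (@symbolHecke L rq.1.1 ⟨rq.1.2.ne_zero⟩ K _)
        (symbolShift K (fun x => A • x)) P (cT rq.1)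
        (fun x hx => (symbolHecke_diagShift_comm (N := L) A hA rq.1.2 hrd x hx.2).symm) rq.2 _ (hPG G Ψ hP)
  have lin : ∀ (G : List ({r : ℕ // r.Prime} × K[X])) (Ψ Ψ' : OnePoint ℚ → OnePoint ℚ → K),
      G.foldr (fun rq Ψ => aeval (@symbolHecke L rq.1.1 ⟨rq.1.2.ne_zero⟩ K _) rq.2 Ψ) (Ψ - Ψ') =
        G.foldr (fun rq Ψ => aeval (@symbolHecke L rq.1.1 ⟨rq.1.2.ne_zero⟩ K _) rq.2 Ψ) Ψ -
          G.foldr (fun rq Ψ => aeval (@symbolHecke L rq.1.1 ⟨rq.1.2.ne_zero⟩ K _) rq.2 Ψ) Ψ' := by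
    intro G
    induction G with
    | nil => intro Ψ Ψ'; rfl
    | cons rq G ih => intro Ψ Ψ'; rw [List.foldr_cons, List.foldr_cons, List.foldr_cons, ih, map_sub]
  intro a b
  have e1 : symbolShift K (fun x => A • x) (wordS Φ₀) = wordS (symbolShift K (fun x => A • x) Φ₀) :=
    comm F (fun _ h => h) Φ₀ ⟨hsym₀, hinv₀⟩
  have e2 : wordS (symbolShift K (fun x => A • x) Φ₀) - wordS Φ₀ = 0 := by
    have : (symbolShift K (fun x => A • x) Φ₀ - Φ₀) = fun a b => Φ₀ (A • a) (A • b) - Φ₀ a b := by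
      funext a b; rfl
    rw [← lin, this]
    exact hkillD
  have e3 := congrFun (congrFun (sub_eq_zero.mp e2) a) b
  rw [← e1, symbolShift_apply] at e3
  exact e3

end Lift

end

end Summit.BirchSwinnertonDyer.BirchSwinnertonDyer.Theorems.ManinLocalTwoThree
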